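/-
Copyright: cell `pub-balaban-gaps` (G2), seat ne6 (row NE7b), `prover-pub-balaban-gaps-ne6-g16-0`. Project licence.
-/
import Literature.MathematicalPhysics.QuantumLattice.SU2HaarChart
import Literature.MathematicalPhysics.QuantumFieldTheory.Balaban1983to89.T4TermwiseSU2
import Mathlib.MeasureTheory.Constructions.HaarToSphere
import Mathlib.MeasureTheory.Measure.Lebesgue.VolumeOfBalls
import Mathlib.Analysis.SpecialFunctions.Trigonometric.InverseDeriv

/-!
# THE `SU(2)` WINDOW LAW EXACTLY: `Haar_{SU(2)}{V : Re tr V ≥ 2 cos ψ} = (ψ − sin ψ cos ψ)∕π` (`0 ≤ ψ ≤ π`) — the cap law behind the (n)-carrier's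
# window-volume letter at rate `3∕2`, from the tree's gnomonic chart of Haar on `SU(2)` (row NE7b, node U5c; MODEL, [folklore]; census V40a)

Cell `pub-balaban-gaps` (G2 spine census) for the `pub-balaban` T⁴ crux NE7b (`T4WeightBudget.RelWeightBound`; NOT PRINTED, NOT PROVED).  Crux-route work under
`Spine/NE7b/`; imports the tree's `Literature…QuantumLattice.SU2HaarChart` (Haar on `SU(2)` = the cone measure of the unit quaternion ball in the gnomonic chart,
`∫ F dHaar = (2π²)⁻¹ ∫_{ℝ³} [F(P(1,v)) + F(P(−(1,v)))](1 + |v|²)⁻² dv`, [Chatterjee2026YMHiggs] §3.2 ∕ Lemma 5.1) and Mathlib's `integral_fun_norm_addHaar`;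
no `def`, zero `sorry`, nothing of Bałaban's asserted.

THE LOCATED QUESTION (census V40; refuter NE7bREF-G99-POST3's request line on V38 `CompactFibreHalvedActionSUN`: the SHARP doubling ∕ halved-action constant reads
`D_true = 1` for `N = 2, 3` by quadrature).  For `N = 2` every route to `D = 1` starts from the EXACT law of the trace window — Weyl ∕ Sato–Tate for `Re tr` on
`SU(2)` in window form — which neither Mathlib nor the tree had (`SU2HaarSmallBall*`, V26 `CompactFibreWindowSU2Rate`: `η√η∕160 ≤ Haar ≤ 12η√η` by inscribed
boxes).  QUESTION (V40a): what is `Haar_{SU(2)}{Re tr V ≥ 2 cos ψ}` exactly?  ANSWER: `(ψ − sin ψ cos ψ)∕π = (2∕π)∫₀^ψ sin²` (**`haar_traceCap_angle_eq`**).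
* §1 `Re tr(quatMatrix q) = 2·re q` (the tree's `T4TermwiseSU2.trace_quatMatrix_re`), hence `Re tr P(±(1, v)) = ±2∕√(1 + |v|²)` at the gnomonic points (`re_trace_quatToSU2_gnomonic`, `…_neg_gnomonic`);
* §2 the radial profile: `∫₀ᵗ r²∕(1+r²)² dr = (arctan t − t∕(1+t²))∕2` (`hasDerivAt_radialPrim`, `integral_radialProfile`), total `π∕4` (`integral_radialProfile_Ioi`);
* §3 radial integration in `ℝ³ = EuclideanSpace ℝ (Fin 3)` (`vol B³ = 4π∕3`): `integral_gnomonicDensity_indicator` (`∫ 𝟙_S(‖x‖)(1 + ‖x‖²)⁻² dx = 4π∫_{S∩(0,∞)} r²∕(1+r²)²`),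
  balls `2π(arctan T − T∕(1+T²))` (`integral_gnomonicDensity_ball`, `…_ball'`), total `π²` (`integral_gnomonicDensity`), complement (`…_ball_compl`);
* §4 the window in gnomonic coordinates and the three cap laws in the tangent parameter `T ≥ 0`: **`haar_traceCap_eq`** (`Haar{Re tr V ≥ 2∕√(1+T²)} =
  (arctan T − T∕(1+T²))∕π`), **`haar_traceCap_neg_eq`** (`Haar{Re tr V ≥ −2∕√(1+T²)} = 1 − (arctan T − T∕(1+T²))∕π`), **`haar_traceCap_zero_eq`** (`½`);
* §5 the angular form **`haar_traceCap_angle_eq`** (`T = tan ψ` ∕ the hemisphere ∕ `T = tan(π − ψ)`).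
Since `Re tr(1 − V) = 2 − Re tr V`, this is the window-volume function of V19∕V26∕V29 for `N = 2` EXACTLY: `Haar{Re tr(1 − V) ≤ 2 − 2cos ψ} = (ψ − sin ψ cos ψ)∕π`;
the sequel (V40b) reads off it that `ψ ↦ (ψ − sin ψ cos ψ)∕sin³(ψ∕2)` is non-increasing (`d∕dψ[3ψ − 4 sin ψ + sin ψ cos ψ] = 2(1 − cos ψ)² ≥ 0`), i.e. V38's
window doubling holds on `SU(2)` with the SHARP constant `D = 1`.

HONEST REMARKS.  (i) MODEL ∕ [folklore] Haar geometry of ONE `SU(2)` variable; nothing of the interacting measure.  (ii) Closed windows only; the density form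
`(2∕π) sin²ψ dψ` of Weyl's integration formula for class functions is NOT derived here.  (iii) (A3) ∕ (A1c) NOT asserted; NC-NE7b-α UNRULED.  BY-NAME EFFECT ON THE
WALL: NONE.  NE7b NOT PRINTED ∕ NOT PROVED; spine PROVED 0∕9; rung (B)+1 on ONE finite T⁴ — NOT infinite volume, NOT the mass gap, NOT Clay.
HONEST DEPENDENCY: continuum YM on T⁴ ⇐ BetaPertH ∧ nine spine estimates (0/9 proved); BetaPertH ⇐ (D1) ∧ (D4) ∧ CAP+tail;
G-an2-4 gates asym, D1 and NE2/3/4.  This file changes none of it.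
-/

set_option autoImplicit false

noncomputable section

open MeasureTheory Real Set Quaternion
open scoped ENNReal Quaternion
open Literature.MathematicalPhysics.QuantumLattice
open Literature.MathematicalPhysics.QuantumFieldTheory (haarProbability)

namespace Summit.QuantumFields.BalabanUV.T4Continuum.NE7b.CompactFibreWindowSU2Exact

/-! ## §1 The trace in the quaternion model: `Re tr(quatMatrix q) = 2·re q`, hence `Re tr P(x) = 2·re x ∕ ‖x‖` -/

/-- `Re tr P(x) = 2·re x∕‖x‖` for `x ≠ 0` (`P = quatToSU2`, the radial projection). [folklore] -/
theorem re_trace_quatToSU2 {x : ℍ} (hx : x ≠ 0) : (Matrix.trace ((quatToSU2 x : Matrix.specialUnitaryGroup (Fin 2) ℂ) : Matrix (Fin 2) (Fin 2) ℂ)).re = 2 * (‖x‖⁻¹ * x.re) := by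
  rw [coe_quatToSU2 hx, Literature.MathematicalPhysics.QuantumFieldTheory.Balaban1983to89.T4TermwiseSU2.trace_quatMatrix_re, Quaternion.re_smul, smul_eq_mul]

/-- At the gnomonic point `(1, v)`: `Re tr P(1, v) = 2∕√(1 + |v|²)`. [folklore] -/
theorem re_trace_quatToSU2_gnomonic (v : Fin 3 → ℝ) :
    (Matrix.trace ((quatToSU2 (gnomonicQuat v) : Matrix.specialUnitaryGroup (Fin 2) ℂ) : Matrix (Fin 2) (Fin 2) ℂ)).re = 2 * (Real.sqrt (1 + ∑ i, v i ^ 2))⁻¹ := by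
  rw [re_trace_quatToSU2 (gnomonicQuat_ne_zero v)]
  have hn : ‖gnomonicQuat v‖ = Real.sqrt (1 + ∑ i, v i ^ 2) := by
    rw [← sq_norm_gnomonicQuat, Real.sqrt_sq (norm_nonneg _)]
  rw [hn, show (gnomonicQuat v).re = 1 from rfl, mul_one]

/-- At the antipodal gnomonic point `−(1, v)`: `Re tr P(−(1, v)) = −2∕√(1 + |v|²)`. [folklore] -/
theorem re_trace_quatToSU2_neg_gnomonic (v : Fin 3 → ℝ) :
    (Matrix.trace ((quatToSU2 (-gnomonicQuat v) : Matrix.specialUnitaryGroup (Fin 2) ℂ) : Matrix (Fin 2) (Fin 2) ℂ)).re = -(2 * (Real.sqrt (1 + ∑ i, v i ^ 2))⁻¹) := by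
  rw [re_trace_quatToSU2 (neg_ne_zero.2 (gnomonicQuat_ne_zero v)), norm_neg]
  have hn : ‖gnomonicQuat v‖ = Real.sqrt (1 + ∑ i, v i ^ 2) := by
    rw [← sq_norm_gnomonicQuat, Real.sqrt_sq (norm_nonneg _)]
  rw [hn, Quaternion.re_neg, show (gnomonicQuat v).re = 1 from rfl]
  ring

/-! ## §2 The radial profile of the gnomonic density: `∫₀ᵗ r²∕(1+r²)² dr = (arctan t − t∕(1+t²))∕2`, total `π∕4` -/

/-- The antiderivative `A(r) = (arctan r − r∕(1+r²))∕2` of the radial profile `r²∕(1+r²)²`. [folklore] -/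
theorem hasDerivAt_radialPrim (r : ℝ) : HasDerivAt (fun r : ℝ => (Real.arctan r - r / (1 + r ^ 2)) / 2) (r ^ 2 / (1 + r ^ 2) ^ 2) r := by
  have h1 : (0 : ℝ) < 1 + r ^ 2 := by positivity
  have hq : HasDerivAt (fun r : ℝ => r / (1 + r ^ 2)) ((1 * (1 + r ^ 2) - r * (2 * r)) / (1 + r ^ 2) ^ 2) r := by
    have hd : HasDerivAt (fun r : ℝ => 1 + r ^ 2) (2 * r) r := by
      simpa using (hasDerivAt_pow 2 r).const_add 1
    exact (hasDerivAt_id r).div hd h1.ne'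
  have h := ((Real.hasDerivAt_arctan r).sub hq).div_const 2
  refine h.congr_deriv ?_
  field_simp
  ring

/-- The radial profile `r ↦ r²∕(1+r²)²` is continuous. [folklore] -/
theorem continuous_radialProfile : Continuous fun r : ℝ => r ^ 2 / (1 + r ^ 2) ^ 2 :=
  (continuous_pow 2).div ((continuous_const.add (continuous_pow 2)).pow 2) fun r => by positivity

/-- `∫₀ᵗ r²∕(1+r²)² dr = (arctan t − t∕(1+t²))∕2`. [folklore] -/
theorem integral_radialProfile (t : ℝ) : ∫ r in (0 : ℝ)..t, r ^ 2 / (1 + r ^ 2) ^ 2 = (Real.arctan t - t / (1 + t ^ 2)) / 2 := by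
  rw [intervalIntegral.integral_eq_sub_of_hasDerivAt (fun r _ => hasDerivAt_radialPrim r) (continuous_radialProfile.intervalIntegrable _ _)]
  simp

/-- The radial profile is integrable on `ℝ` (dominated by `(1 + r²)⁻¹`). [folklore] -/
theorem integrable_radialProfile : Integrable fun r : ℝ => r ^ 2 / (1 + r ^ 2) ^ 2 := by
  refine Integrable.mono' integrable_inv_one_add_sq continuous_radialProfile.aestronglyMeasurable (ae_of_all _ fun r => ?_)
  have h1 : (0 : ℝ) < 1 + r ^ 2 := by positivity
  rw [Real.norm_eq_abs, abs_of_nonneg (by positivity), div_le_iff₀ (pow_pos h1 2), sq (1 + r ^ 2), ← mul_assoc, inv_mul_cancel₀ h1.ne', one_mul]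
  nlinarith [sq_nonneg r]

/-- The gnomonic density profile `r ↦ (1 + r²)⁻²` is measurable. [folklore] -/
theorem measurable_gDensity : Measurable fun r : ℝ => ((1 + r ^ 2)⁻¹) ^ 2 :=
  ((continuous_const.add (continuous_pow 2)).inv₀ fun r => (by positivity : (1 : ℝ) + r ^ 2 ≠ 0)).measurable.pow_const 2

/-- `∫₀^∞ r²∕(1+r²)² dr = π∕4`. [folklore] -/
theorem integral_radialProfile_Ioi : ∫ r in Ioi (0 : ℝ), r ^ 2 / (1 + r ^ 2) ^ 2 = Real.pi / 4 := by
  have hlim : Filter.Tendsto (fun r : ℝ => (Real.arctan r - r / (1 + r ^ 2)) / 2) Filter.atTop (nhds ((Real.pi / 2 - 0) / 2)) := by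
    refine ((Real.tendsto_arctan_atTop.mono_right nhdsWithin_le_nhds).sub ?_).div_const 2
    -- `r/(1+r²) → 0`
    have h : Filter.Tendsto (fun r : ℝ => r⁻¹) Filter.atTop (nhds 0) := tendsto_inv_atTop_zero
    refine squeeze_zero' (Filter.eventually_of_mem (Filter.Ioi_mem_atTop 0) fun r (hr : 0 < r) => by positivity)
      (Filter.eventually_of_mem (Filter.Ioi_mem_atTop 0) fun r (hr : 0 < r) => ?_) h
    have h1 : (0 : ℝ) < 1 + r ^ 2 := by positivity
    rw [div_le_iff₀ h1, inv_mul_eq_div, le_div_iff₀ hr]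
    nlinarith
  rw [integral_Ioi_of_hasDerivAt_of_tendsto' (fun r _ => hasDerivAt_radialPrim r) integrable_radialProfile.integrableOn hlim]
  simp; ring

/-! ## §3 The gnomonic density integrated over Euclidean balls of `ℝ³`: `∫_{|v| ≤ T} (1+|v|²)⁻² dv = 2π(arctan T − T∕(1+T²))`, total `π²` -/

/-- The squared Euclidean length `Σ vᵢ²` of `v : Fin 3 → ℝ` is the squared norm of `toLp 2 v ∈ ℝ³`. [folklore] -/
theorem sum_sq_eq_norm_toLp_sq (v : Fin 3 → ℝ) : ∑ i, v i ^ 2 = ‖(WithLp.toLp 2 v : EuclideanSpace ℝ (Fin 3))‖ ^ 2 := by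
  rw [EuclideanSpace.real_norm_sq_eq]

/-- The unit ball of `ℝ³` has volume `4π∕3` (real form of Mathlib's `volume_ball_fin_three`). [folklore] -/
theorem volume_real_ball_three : (volume : Measure (EuclideanSpace ℝ (Fin 3))).real (Metric.ball 0 1) = Real.pi * 4 / 3 := by
  rw [measureReal_def, EuclideanSpace.volume_ball_fin_three, ENNReal.ofReal_one, one_pow, one_mul, ENNReal.toReal_ofReal (by positivity)]

/-- Radial integration of a cut-off of the gnomonic density over `ℝ³`: for measurable `S ⊆ ℝ`,
`∫_{ℝ³} 𝟙_S(‖x‖)·(1 + ‖x‖²)⁻² dx = 4π·∫_{S ∩ (0,∞)} r²∕(1+r²)² dr`. [folklore] -/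
theorem integral_gnomonicDensity_indicator {S : Set ℝ} (hS : MeasurableSet S) :
    ∫ x : EuclideanSpace ℝ (Fin 3), S.indicator (fun r : ℝ => ((1 + r ^ 2)⁻¹) ^ 2) ‖x‖ = 4 * Real.pi * ∫ y in S ∩ Ioi 0, y ^ 2 / (1 + y ^ 2) ^ 2 := by
  have hdim : Module.finrank ℝ (EuclideanSpace ℝ (Fin 3)) = 3 := finrank_euclideanSpace_fin
  rw [integral_fun_norm_addHaar (volume : Measure (EuclideanSpace ℝ (Fin 3))) (fun r : ℝ => S.indicator (fun r : ℝ => ((1 + r ^ 2)⁻¹) ^ 2) r), hdim,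
    volume_real_ball_three]
  have hfun : ∀ y : ℝ, y ^ (3 - 1) • S.indicator (fun r : ℝ => ((1 + r ^ 2)⁻¹) ^ 2) y = S.indicator (fun r : ℝ => r ^ 2 / (1 + r ^ 2) ^ 2) y := by
    intro y
    by_cases hy : y ∈ S
    · rw [Set.indicator_of_mem hy, Set.indicator_of_mem hy, smul_eq_mul]; field_simp
    · rw [Set.indicator_of_notMem hy, Set.indicator_of_notMem hy, smul_zero]
  simp_rw [hfun]
  rw [integral_indicator hS, Measure.restrict_restrict hS, nsmul_eq_mul, smul_eq_mul]
  push_cast; ring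

/-- Closed ball: `∫_{ℝ³} 𝟙{‖x‖ ≤ T}·(1 + ‖x‖²)⁻² dx = 2π(arctan T − T∕(1+T²))` (`T ≥ 0`). [folklore] -/
theorem integral_gnomonicDensity_ball {T : ℝ} (hT : 0 ≤ T) :
    ∫ x : EuclideanSpace ℝ (Fin 3), (Set.Iic T).indicator (fun r : ℝ => ((1 + r ^ 2)⁻¹) ^ 2) ‖x‖ = 2 * Real.pi * (Real.arctan T - T / (1 + T ^ 2)) := by
  rw [integral_gnomonicDensity_indicator measurableSet_Iic, show Set.Iic T ∩ Set.Ioi 0 = Set.Ioc 0 T from by ext y; simp [and_comm],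
    ← intervalIntegral.integral_of_le hT, integral_radialProfile]
  ring

/-- Open ball: `∫_{ℝ³} 𝟙{‖x‖ < T}·(1 + ‖x‖²)⁻² dx = 2π(arctan T − T∕(1+T²))` (`T ≥ 0`). [folklore] -/
theorem integral_gnomonicDensity_ball' {T : ℝ} (hT : 0 ≤ T) :
    ∫ x : EuclideanSpace ℝ (Fin 3), (Set.Iio T).indicator (fun r : ℝ => ((1 + r ^ 2)⁻¹) ^ 2) ‖x‖ = 2 * Real.pi * (Real.arctan T - T / (1 + T ^ 2)) := by
  rw [integral_gnomonicDensity_indicator measurableSet_Iio, show Set.Iio T ∩ Set.Ioi 0 = Set.Ioo 0 T from by ext y; simp [and_comm],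
    ← integral_Ioc_eq_integral_Ioo, ← intervalIntegral.integral_of_le hT, integral_radialProfile]
  ring

/-- The whole gnomonic density: `∫_{ℝ³} (1 + ‖x‖²)⁻² dx = π²`. [folklore] -/
theorem integral_gnomonicDensity :
    ∫ x : EuclideanSpace ℝ (Fin 3), ((1 + ‖x‖ ^ 2)⁻¹) ^ 2 = Real.pi ^ 2 := by
  have hdim : Module.finrank ℝ (EuclideanSpace ℝ (Fin 3)) = 3 := finrank_euclideanSpace_fin
  rw [integral_fun_norm_addHaar (volume : Measure (EuclideanSpace ℝ (Fin 3))) (fun r : ℝ => ((1 + r ^ 2)⁻¹) ^ 2), hdim, volume_real_ball_three]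
  have hfun : ∀ y : ℝ, y ^ (3 - 1) • ((1 + y ^ 2)⁻¹) ^ 2 = y ^ 2 / (1 + y ^ 2) ^ 2 := fun y => by rw [smul_eq_mul]; field_simp
  simp_rw [hfun]
  rw [integral_radialProfile_Ioi, nsmul_eq_mul, smul_eq_mul]
  push_cast; ring

/-- The gnomonic density `x ↦ (1 + ‖x‖²)⁻²` is integrable on `ℝ³`. [folklore] -/
theorem integrable_gnomonicDensity : Integrable (fun x : EuclideanSpace ℝ (Fin 3) => ((1 + ‖x‖ ^ 2)⁻¹) ^ 2) := by
  have hdim : Module.finrank ℝ (EuclideanSpace ℝ (Fin 3)) = 3 := finrank_euclideanSpace_fin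
  have h := (integrable_fun_norm_addHaar (volume : Measure (EuclideanSpace ℝ (Fin 3))) (f := fun r : ℝ => ((1 + r ^ 2)⁻¹) ^ 2)).2
  refine h ?_
  rw [hdim]
  have hfun : ∀ y : ℝ, y ^ (3 - 1) • ((1 + y ^ 2)⁻¹) ^ 2 = y ^ 2 / (1 + y ^ 2) ^ 2 := fun y => by rw [smul_eq_mul]; field_simp
  simp_rw [hfun]
  exact integrable_radialProfile.integrableOn

/-! ## §4 The trace window of `SU(2)` in gnomonic coordinates and its Haar mass -/

/-- Upper hemisphere: `2∕√(1 + |v|²) ≥ 2∕√(1 + T²)` iff `|v|² ≤ T²` (`T ≥ 0`). [folklore] -/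
theorem two_div_sqrt_ge_iff {T s : ℝ} (hs : 0 ≤ s) :
    2 * (Real.sqrt (1 + T ^ 2))⁻¹ ≤ 2 * (Real.sqrt (1 + s))⁻¹ ↔ s ≤ T ^ 2 := by
  have h1 : 0 < Real.sqrt (1 + T ^ 2) := Real.sqrt_pos.2 (by positivity)
  have h2 : 0 < Real.sqrt (1 + s) := Real.sqrt_pos.2 (by positivity)
  rw [mul_le_mul_iff_right₀ (two_pos : (0 : ℝ) < 2), inv_le_inv₀ h1 h2, Real.sqrt_le_sqrt_iff (by positivity)]
  constructor <;> intro h <;> linarith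

/-- Lower hemisphere: `−2∕√(1 + |v|²) ≥ 2∕√(1 + T²)` never holds. [folklore] -/
theorem not_two_div_sqrt_le_neg {T s : ℝ} (hs : 0 ≤ s) :
    ¬ 2 * (Real.sqrt (1 + T ^ 2))⁻¹ ≤ -(2 * (Real.sqrt (1 + s))⁻¹) := by
  have h1 : 0 < Real.sqrt (1 + T ^ 2) := Real.sqrt_pos.2 (by positivity)
  have h2 : 0 < Real.sqrt (1 + s) := Real.sqrt_pos.2 (by positivity)
  intro h; linarith [show 0 < 2 * (Real.sqrt (1 + T ^ 2))⁻¹ by positivity, show 0 < 2 * (Real.sqrt (1 + s))⁻¹ by positivity]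

/-- The trace window `{V : 2∕√(1+T²) ≤ Re tr V}` (a cap about the identity of angular radius `arctan T`) is measurable. [folklore] -/
theorem measurableSet_traceCap (a : ℝ) : MeasurableSet {V : Matrix.specialUnitaryGroup (Fin 2) ℂ | a ≤ (Matrix.trace (V : Matrix (Fin 2) (Fin 2) ℂ)).re} :=
  measurableSet_le measurable_const (Complex.continuous_re.comp (continuous_subtype_val.matrix_trace)).measurable

/-- **THE CAP LAW OF `SU(2)` (upper hemisphere)**: for `T ≥ 0`,
`Haar_{SU(2)}{V : Re tr V ≥ 2∕√(1 + T²)} = (arctan T − T∕(1 + T²))∕π` — the cap of angular radius `ψ₀ = arctan T` about `1` has mass `(ψ₀ − sin ψ₀ cos ψ₀)∕π`. [folklore] -/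
theorem haar_traceCap_eq {T : ℝ} (hT : 0 ≤ T) :
    haarProbability (Matrix.specialUnitaryGroup (Fin 2) ℂ) {V : Matrix.specialUnitaryGroup (Fin 2) ℂ | 2 * (Real.sqrt (1 + T ^ 2))⁻¹ ≤ (Matrix.trace (V : Matrix (Fin 2) (Fin 2) ℂ)).re}
      = ENNReal.ofReal ((Real.arctan T - T / (1 + T ^ 2)) / Real.pi) := by
  set W : Set (Matrix.specialUnitaryGroup (Fin 2) ℂ) := {V : Matrix.specialUnitaryGroup (Fin 2) ℂ | 2 * (Real.sqrt (1 + T ^ 2))⁻¹ ≤ (Matrix.trace (V : Matrix (Fin 2) (Fin 2) ℂ)).re} with hW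
  have hWm : MeasurableSet W := measurableSet_traceCap _
  rw [← lintegral_indicator_one hWm, lintegral_haarProbability_su2_gnomonic _ (measurable_one.indicator hWm)]
  -- the integrand in gnomonic coordinates is the cut-off density on the Euclidean ball of radius `T`
  have hint : ∀ v : Fin 3 → ℝ, (W.indicator 1 (quatToSU2 (gnomonicQuat v)) + W.indicator 1 (quatToSU2 (-gnomonicQuat v))) * ENNReal.ofReal (((1 + ∑ i, v i ^ 2)⁻¹) ^ 2)
      = ENNReal.ofReal ((Set.Iic T).indicator (fun r : ℝ => ((1 + r ^ 2)⁻¹) ^ 2) ‖(WithLp.toLp 2 v : EuclideanSpace ℝ (Fin 3))‖) := by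
    intro v
    have hs : 0 ≤ ∑ i, v i ^ 2 := Finset.sum_nonneg fun i _ => sq_nonneg _
    have hlow : quatToSU2 (-gnomonicQuat v) ∉ W := by
      rw [hW, Set.mem_setOf_eq, re_trace_quatToSU2_neg_gnomonic]; exact not_two_div_sqrt_le_neg hs
    rw [Set.indicator_of_notMem hlow, add_zero]
    have hnorm : ‖(WithLp.toLp 2 v : EuclideanSpace ℝ (Fin 3))‖ ^ 2 = ∑ i, v i ^ 2 := (sum_sq_eq_norm_toLp_sq v).symm
    by_cases hv : ∑ i, v i ^ 2 ≤ T ^ 2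
    · have hup : quatToSU2 (gnomonicQuat v) ∈ W := by
        rw [hW, Set.mem_setOf_eq, re_trace_quatToSU2_gnomonic]; exact (two_div_sqrt_ge_iff hs).2 hv
      have hr : ‖(WithLp.toLp 2 v : EuclideanSpace ℝ (Fin 3))‖ ∈ Set.Iic T := by
        rw [Set.mem_Iic]; exact (pow_le_pow_iff_left₀ (norm_nonneg _) hT two_ne_zero).1 (by rw [hnorm]; exact hv)
      rw [Set.indicator_of_mem hup, Set.indicator_of_mem hr, Pi.one_apply, one_mul, hnorm]
    · have hup : quatToSU2 (gnomonicQuat v) ∉ W := by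
        rw [hW, Set.mem_setOf_eq, re_trace_quatToSU2_gnomonic]; exact fun h => hv ((two_div_sqrt_ge_iff hs).1 h)
      have hr : ‖(WithLp.toLp 2 v : EuclideanSpace ℝ (Fin 3))‖ ∉ Set.Iic T := by
        rw [Set.mem_Iic]; intro h; exact hv (by rw [← hnorm]; exact pow_le_pow_left₀ (norm_nonneg _) h 2)
      rw [Set.indicator_of_notMem hup, zero_mul, Set.indicator_of_notMem hr, ENNReal.ofReal_zero]
  simp_rw [hint]
  -- transport to `ℝ³` and to the Bochner integral
  have hFm : Measurable fun x : EuclideanSpace ℝ (Fin 3) => (Set.Iic T).indicator (fun r : ℝ => ((1 + r ^ 2)⁻¹) ^ 2) ‖x‖ :=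
    (measurable_gDensity.indicator measurableSet_Iic).comp measurable_norm
  have hmeasE : Measurable fun x : EuclideanSpace ℝ (Fin 3) => ENNReal.ofReal ((Set.Iic T).indicator (fun r : ℝ => ((1 + r ^ 2)⁻¹) ^ 2) ‖x‖) :=
    ENNReal.measurable_ofReal.comp hFm
  have hcomp := (PiLp.volume_preserving_toLp (Fin 3)).lintegral_comp hmeasE
  rw [hcomp]
  -- the Bochner integral on `ℝ³`
  have hF0 : ∀ x : EuclideanSpace ℝ (Fin 3), 0 ≤ (Set.Iic T).indicator (fun r : ℝ => ((1 + r ^ 2)⁻¹) ^ 2) ‖x‖ :=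
    fun x => Set.indicator_nonneg (fun r _ => by positivity) _
  have hFi : Integrable (fun x : EuclideanSpace ℝ (Fin 3) => (Set.Iic T).indicator (fun r : ℝ => ((1 + r ^ 2)⁻¹) ^ 2) ‖x‖) :=
    Integrable.mono' integrable_gnomonicDensity hFm.aestronglyMeasurable (ae_of_all _ fun x => by
      rw [Real.norm_eq_abs, abs_of_nonneg (hF0 x)]
      exact Set.indicator_le_self' (fun r _ => by positivity) _)
  rw [← ofReal_integral_eq_lintegral_ofReal hFi (ae_of_all _ hF0), integral_gnomonicDensity_ball hT,
    ← ENNReal.ofReal_mul (by positivity)]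
  congr 1; field_simp

/-- The complement of the open ball: `∫_{ℝ³} 𝟙{T ≤ ‖x‖}·(1 + ‖x‖²)⁻² dx = π² − 2π(arctan T − T∕(1+T²))` (`T ≥ 0`). [folklore] -/
theorem integral_gnomonicDensity_ball_compl {T : ℝ} (hT : 0 ≤ T) :
    ∫ x : EuclideanSpace ℝ (Fin 3), (Set.Ici T).indicator (fun r : ℝ => ((1 + r ^ 2)⁻¹) ^ 2) ‖x‖ = Real.pi ^ 2 - 2 * Real.pi * (Real.arctan T - T / (1 + T ^ 2)) := by
  have hsplit : ∀ x : EuclideanSpace ℝ (Fin 3), (Set.Ici T).indicator (fun r : ℝ => ((1 + r ^ 2)⁻¹) ^ 2) ‖x‖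
      = ((1 + ‖x‖ ^ 2)⁻¹) ^ 2 - (Set.Iio T).indicator (fun r : ℝ => ((1 + r ^ 2)⁻¹) ^ 2) ‖x‖ := by
    intro x
    by_cases h : ‖x‖ < T
    · rw [Set.indicator_of_notMem (fun hx : ‖x‖ ∈ Set.Ici T => (not_le.2 h) hx), Set.indicator_of_mem (Set.mem_Iio.2 h)]; ring
    · rw [Set.indicator_of_mem (show ‖x‖ ∈ Set.Ici T from not_lt.1 h), Set.indicator_of_notMem (fun hx : ‖x‖ ∈ Set.Iio T => h hx)]; ring
  have hFi : Integrable (fun x : EuclideanSpace ℝ (Fin 3) => (Set.Iio T).indicator (fun r : ℝ => ((1 + r ^ 2)⁻¹) ^ 2) ‖x‖) :=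
    Integrable.mono' integrable_gnomonicDensity (((measurable_gDensity.indicator measurableSet_Iio).comp measurable_norm).aestronglyMeasurable) (ae_of_all _ fun x => by
      rw [Real.norm_eq_abs, abs_of_nonneg (Set.indicator_nonneg (fun r _ => by positivity) _)]
      exact Set.indicator_le_self' (fun r _ => by positivity) _)
  simp_rw [hsplit]
  rw [integral_sub integrable_gnomonicDensity hFi, integral_gnomonicDensity, integral_gnomonicDensity_ball' hT]

/-- Lower hemisphere vs lower caps: `−2∕√(1 + T²) ≤ −2∕√(1 + |v|²)` iff `T² ≤ |v|²`. [folklore] -/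
theorem neg_two_div_sqrt_le_neg_iff {T s : ℝ} (hs : 0 ≤ s) :
    -(2 * (Real.sqrt (1 + T ^ 2))⁻¹) ≤ -(2 * (Real.sqrt (1 + s))⁻¹) ↔ T ^ 2 ≤ s := by
  have h1 : 0 < Real.sqrt (1 + T ^ 2) := Real.sqrt_pos.2 (by positivity)
  have h2 : 0 < Real.sqrt (1 + s) := Real.sqrt_pos.2 (by positivity)
  rw [neg_le_neg_iff, mul_le_mul_iff_right₀ (two_pos : (0 : ℝ) < 2), inv_le_inv₀ h2 h1, Real.sqrt_le_sqrt_iff (by positivity)]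
  constructor <;> intro h <;> linarith

/-- **THE CAP LAW OF `SU(2)` (caps larger than a hemisphere)**: for `T ≥ 0`,
`Haar_{SU(2)}{V : Re tr V ≥ −2∕√(1 + T²)} = 1 − (arctan T − T∕(1 + T²))∕π` (angular radius `π − arctan T`). [folklore] -/
theorem haar_traceCap_neg_eq {T : ℝ} (hT : 0 ≤ T) :
    haarProbability (Matrix.specialUnitaryGroup (Fin 2) ℂ) {V : Matrix.specialUnitaryGroup (Fin 2) ℂ | -(2 * (Real.sqrt (1 + T ^ 2))⁻¹) ≤ (Matrix.trace (V : Matrix (Fin 2) (Fin 2) ℂ)).re}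
      = ENNReal.ofReal (1 - (Real.arctan T - T / (1 + T ^ 2)) / Real.pi) := by
  set W : Set (Matrix.specialUnitaryGroup (Fin 2) ℂ) := {V : Matrix.specialUnitaryGroup (Fin 2) ℂ | -(2 * (Real.sqrt (1 + T ^ 2))⁻¹) ≤ (Matrix.trace (V : Matrix (Fin 2) (Fin 2) ℂ)).re} with hW
  have hWm : MeasurableSet W := measurableSet_traceCap _
  rw [← lintegral_indicator_one hWm, lintegral_haarProbability_su2_gnomonic _ (measurable_one.indicator hWm)]
  have hint : ∀ v : Fin 3 → ℝ, (W.indicator 1 (quatToSU2 (gnomonicQuat v)) + W.indicator 1 (quatToSU2 (-gnomonicQuat v))) * ENNReal.ofReal (((1 + ∑ i, v i ^ 2)⁻¹) ^ 2)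
      = ENNReal.ofReal (((1 + ‖(WithLp.toLp 2 v : EuclideanSpace ℝ (Fin 3))‖ ^ 2)⁻¹) ^ 2 + (Set.Ici T).indicator (fun r : ℝ => ((1 + r ^ 2)⁻¹) ^ 2) ‖(WithLp.toLp 2 v : EuclideanSpace ℝ (Fin 3))‖) := by
    intro v
    have hs : 0 ≤ ∑ i, v i ^ 2 := Finset.sum_nonneg fun i _ => sq_nonneg _
    have hnorm : ‖(WithLp.toLp 2 v : EuclideanSpace ℝ (Fin 3))‖ ^ 2 = ∑ i, v i ^ 2 := (sum_sq_eq_norm_toLp_sq v).symm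
    have hup : quatToSU2 (gnomonicQuat v) ∈ W := by
      rw [hW, Set.mem_setOf_eq, re_trace_quatToSU2_gnomonic]
      have h1 : 0 < Real.sqrt (1 + T ^ 2) := Real.sqrt_pos.2 (by positivity)
      have h2 : 0 < Real.sqrt (1 + ∑ i, v i ^ 2) := Real.sqrt_pos.2 (by positivity)
      linarith [show 0 < 2 * (Real.sqrt (1 + T ^ 2))⁻¹ by positivity, show 0 < 2 * (Real.sqrt (1 + ∑ i, v i ^ 2))⁻¹ by positivity]
    rw [Set.indicator_of_mem hup, Pi.one_apply, hnorm]
    by_cases hv : T ^ 2 ≤ ∑ i, v i ^ 2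
    · have hlow : quatToSU2 (-gnomonicQuat v) ∈ W := by
        rw [hW, Set.mem_setOf_eq, re_trace_quatToSU2_neg_gnomonic]; exact (neg_two_div_sqrt_le_neg_iff hs).2 hv
      have hr : ‖(WithLp.toLp 2 v : EuclideanSpace ℝ (Fin 3))‖ ∈ Set.Ici T := by
        rw [Set.mem_Ici]; exact (pow_le_pow_iff_left₀ hT (norm_nonneg _) two_ne_zero).1 (by rw [hnorm]; exact hv)
      rw [Set.indicator_of_mem hlow, Set.indicator_of_mem hr, Pi.one_apply, hnorm, ENNReal.ofReal_add (by positivity) (by positivity)]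
      ring
    · have hlow : quatToSU2 (-gnomonicQuat v) ∉ W := by
        rw [hW, Set.mem_setOf_eq, re_trace_quatToSU2_neg_gnomonic]; exact fun h => hv ((neg_two_div_sqrt_le_neg_iff hs).1 h)
      have hr : ‖(WithLp.toLp 2 v : EuclideanSpace ℝ (Fin 3))‖ ∉ Set.Ici T := by
        rw [Set.mem_Ici]; intro h; exact hv (by rw [← hnorm]; exact pow_le_pow_left₀ hT h 2)
      rw [Set.indicator_of_notMem hlow, add_zero, Set.indicator_of_notMem hr, add_zero, one_mul]
  simp_rw [hint]
  have hFm : Measurable fun x : EuclideanSpace ℝ (Fin 3) => ((1 + ‖x‖ ^ 2)⁻¹) ^ 2 + (Set.Ici T).indicator (fun r : ℝ => ((1 + r ^ 2)⁻¹) ^ 2) ‖x‖ :=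
    (measurable_gDensity.comp measurable_norm).add ((measurable_gDensity.indicator measurableSet_Ici).comp measurable_norm)
  have hmeasE : Measurable fun x : EuclideanSpace ℝ (Fin 3) => ENNReal.ofReal (((1 + ‖x‖ ^ 2)⁻¹) ^ 2 + (Set.Ici T).indicator (fun r : ℝ => ((1 + r ^ 2)⁻¹) ^ 2) ‖x‖) :=
    ENNReal.measurable_ofReal.comp hFm
  have hcomp := (PiLp.volume_preserving_toLp (Fin 3)).lintegral_comp hmeasE
  rw [hcomp]
  have hF0 : ∀ x : EuclideanSpace ℝ (Fin 3), 0 ≤ ((1 + ‖x‖ ^ 2)⁻¹) ^ 2 + (Set.Ici T).indicator (fun r : ℝ => ((1 + r ^ 2)⁻¹) ^ 2) ‖x‖ :=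
    fun x => add_nonneg (by positivity) (Set.indicator_nonneg (fun r _ => by positivity) _)
  have hIi : Integrable (fun x : EuclideanSpace ℝ (Fin 3) => (Set.Ici T).indicator (fun r : ℝ => ((1 + r ^ 2)⁻¹) ^ 2) ‖x‖) :=
    Integrable.mono' integrable_gnomonicDensity (((measurable_gDensity.indicator measurableSet_Ici).comp measurable_norm).aestronglyMeasurable) (ae_of_all _ fun x => by
      rw [Real.norm_eq_abs, abs_of_nonneg (Set.indicator_nonneg (fun r _ => by positivity) _)]
      exact Set.indicator_le_self' (fun r _ => by positivity) _)
  have hFi : Integrable (fun x : EuclideanSpace ℝ (Fin 3) => ((1 + ‖x‖ ^ 2)⁻¹) ^ 2 + (Set.Ici T).indicator (fun r : ℝ => ((1 + r ^ 2)⁻¹) ^ 2) ‖x‖) :=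
    integrable_gnomonicDensity.add hIi
  rw [← ofReal_integral_eq_lintegral_ofReal hFi (ae_of_all _ hF0), integral_add integrable_gnomonicDensity hIi, integral_gnomonicDensity,
    integral_gnomonicDensity_ball_compl hT, ← ENNReal.ofReal_mul (by positivity)]
  congr 1; field_simp; ring

/-- **THE HEMISPHERE**: `Haar_{SU(2)}{V : Re tr V ≥ 0} = ½`. [folklore] -/
theorem haar_traceCap_zero_eq :
    haarProbability (Matrix.specialUnitaryGroup (Fin 2) ℂ) {V : Matrix.specialUnitaryGroup (Fin 2) ℂ | 0 ≤ (Matrix.trace (V : Matrix (Fin 2) (Fin 2) ℂ)).re} = ENNReal.ofReal (1 / 2) := by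
  set W : Set (Matrix.specialUnitaryGroup (Fin 2) ℂ) := {V : Matrix.specialUnitaryGroup (Fin 2) ℂ | 0 ≤ (Matrix.trace (V : Matrix (Fin 2) (Fin 2) ℂ)).re} with hW
  have hWm : MeasurableSet W := measurableSet_traceCap _
  rw [← lintegral_indicator_one hWm, lintegral_haarProbability_su2_gnomonic _ (measurable_one.indicator hWm)]
  have hint : ∀ v : Fin 3 → ℝ, (W.indicator 1 (quatToSU2 (gnomonicQuat v)) + W.indicator 1 (quatToSU2 (-gnomonicQuat v))) * ENNReal.ofReal (((1 + ∑ i, v i ^ 2)⁻¹) ^ 2)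
      = ENNReal.ofReal (((1 + ‖(WithLp.toLp 2 v : EuclideanSpace ℝ (Fin 3))‖ ^ 2)⁻¹) ^ 2) := by
    intro v
    have hnorm : ‖(WithLp.toLp 2 v : EuclideanSpace ℝ (Fin 3))‖ ^ 2 = ∑ i, v i ^ 2 := (sum_sq_eq_norm_toLp_sq v).symm
    have hpos : 0 < 2 * (Real.sqrt (1 + ∑ i, v i ^ 2))⁻¹ := by
      have : 0 < Real.sqrt (1 + ∑ i, v i ^ 2) := Real.sqrt_pos.2 (by positivity)
      positivity
    have hup : quatToSU2 (gnomonicQuat v) ∈ W := by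
      rw [hW, Set.mem_setOf_eq, re_trace_quatToSU2_gnomonic]; exact hpos.le
    have hlow : quatToSU2 (-gnomonicQuat v) ∉ W := by
      rw [hW, Set.mem_setOf_eq, re_trace_quatToSU2_neg_gnomonic]; intro h; linarith
    rw [Set.indicator_of_mem hup, Set.indicator_of_notMem hlow, Pi.one_apply, add_zero, one_mul, hnorm]
  simp_rw [hint]
  have hmeasE : Measurable fun x : EuclideanSpace ℝ (Fin 3) => ENNReal.ofReal (((1 + ‖x‖ ^ 2)⁻¹) ^ 2) :=
    ENNReal.measurable_ofReal.comp (measurable_gDensity.comp measurable_norm)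
  have hcomp := (PiLp.volume_preserving_toLp (Fin 3)).lintegral_comp hmeasE
  rw [hcomp, ← ofReal_integral_eq_lintegral_ofReal integrable_gnomonicDensity (ae_of_all _ fun x => by positivity), integral_gnomonicDensity,
    ← ENNReal.ofReal_mul (by positivity)]
  congr 1; field_simp

/-! ## §5 The cap law in the angular variable: `Haar_{SU(2)}{Re tr V ≥ 2 cos ψ} = (ψ − sin ψ cos ψ)∕π`, `0 ≤ ψ ≤ π` -/

/-- `tan θ∕(1 + tan² θ) = sin θ cos θ` when `cos θ ≠ 0`. [folklore] -/
theorem tan_div_one_add_tan_sq {θ : ℝ} (hc : Real.cos θ ≠ 0) : Real.tan θ / (1 + Real.tan θ ^ 2) = Real.sin θ * Real.cos θ := by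
  rw [div_eq_mul_inv, Real.inv_one_add_tan_sq hc, Real.tan_eq_sin_div_cos]
  field_simp

/-- **THE CAP LAW OF `SU(2)` IN THE ANGULAR VARIABLE** (Weyl ∕ Sato–Tate for the trace of `SU(2)`, in window form): for `0 ≤ ψ ≤ π`,
`Haar_{SU(2)}{V : Re tr V ≥ 2 cos ψ} = (ψ − sin ψ cos ψ)∕π` — the normalised Haar mass of the cap of angular radius `ψ` about the identity
(`= (2∕π)∫₀^ψ sin²`). [folklore] -/
theorem haar_traceCap_angle_eq {ψ : ℝ} (h0 : 0 ≤ ψ) (hπ : ψ ≤ Real.pi) :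
    haarProbability (Matrix.specialUnitaryGroup (Fin 2) ℂ) {V : Matrix.specialUnitaryGroup (Fin 2) ℂ | 2 * Real.cos ψ ≤ (Matrix.trace (V : Matrix (Fin 2) (Fin 2) ℂ)).re}
      = ENNReal.ofReal ((ψ - Real.sin ψ * Real.cos ψ) / Real.pi) := by
  rcases lt_trichotomy ψ (Real.pi / 2) with hlt | heq | hgt
  · -- a cap inside the upper hemisphere: `T = tan ψ`
    have hcos : 0 < Real.cos ψ := Real.cos_pos_of_mem_Ioo ⟨by linarith [Real.pi_pos], hlt⟩
    have hT : 0 ≤ Real.tan ψ := Real.tan_nonneg_of_nonneg_of_le_pi_div_two h0 hlt.le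
    have hset : {V : Matrix.specialUnitaryGroup (Fin 2) ℂ | 2 * Real.cos ψ ≤ (Matrix.trace (V : Matrix (Fin 2) (Fin 2) ℂ)).re}
        = {V : Matrix.specialUnitaryGroup (Fin 2) ℂ | 2 * (Real.sqrt (1 + Real.tan ψ ^ 2))⁻¹ ≤ (Matrix.trace (V : Matrix (Fin 2) (Fin 2) ℂ)).re} := by
      rw [Real.inv_sqrt_one_add_tan_sq hcos]
    rw [hset, haar_traceCap_eq hT, Real.arctan_tan (by linarith [Real.pi_pos]) hlt, tan_div_one_add_tan_sq hcos.ne']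
  · -- the hemisphere
    subst heq
    rw [Real.cos_pi_div_two, Real.sin_pi_div_two, mul_zero, haar_traceCap_zero_eq]
    congr 1; field_simp; ring
  · -- a cap larger than a hemisphere: `T = tan(π − ψ)`
    have hθ0 : 0 ≤ Real.pi - ψ := by linarith
    have hθlt : Real.pi - ψ < Real.pi / 2 := by linarith
    have hcos : 0 < Real.cos (Real.pi - ψ) := Real.cos_pos_of_mem_Ioo ⟨by linarith [Real.pi_pos], hθlt⟩
    have hT : 0 ≤ Real.tan (Real.pi - ψ) := Real.tan_nonneg_of_nonneg_of_le_pi_div_two hθ0 hθlt.le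
    have hset : {V : Matrix.specialUnitaryGroup (Fin 2) ℂ | 2 * Real.cos ψ ≤ (Matrix.trace (V : Matrix (Fin 2) (Fin 2) ℂ)).re}
        = {V : Matrix.specialUnitaryGroup (Fin 2) ℂ | -(2 * (Real.sqrt (1 + Real.tan (Real.pi - ψ) ^ 2))⁻¹) ≤ (Matrix.trace (V : Matrix (Fin 2) (Fin 2) ℂ)).re} := by
      rw [Real.inv_sqrt_one_add_tan_sq hcos, Real.cos_pi_sub]; simp only [mul_neg, neg_neg]
    rw [hset, haar_traceCap_neg_eq hT, Real.arctan_tan (by linarith [Real.pi_pos]) hθlt, tan_div_one_add_tan_sq hcos.ne',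
      Real.sin_pi_sub, Real.cos_pi_sub]
    congr 1; field_simp; ring

end Summit.QuantumFields.BalabanUV.T4Continuum.NE7b.CompactFibreWindowSU2Exact

end
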